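import Summits.AtomisticToContinuum.Crystallization.Theorems.FrustratedLawDichotomyStrainedPatchHomEntryLeafHTA2QCellG72EV2

/-!
# v3 T0 CELL `cG72E × wG72E` (0.725 t_b, EIGHT-coarse: 2⁻¹⁰ on (0,0), 2⁻⁹ else (k₆ = 5)), part 3: far sum, ONE inner hull leaf, END TO END in the v3 currency
# (27623 `(H) HomFloor (1/625)`, hcp half; hand-1 g38; T0 cell under critic row 1437 (E) «T0 ≤ 500 core-h RELEASED (anchors + ≤ 40 cells)»; payloads from hand-1 g37 probes `G72P8` a/b/c + hand-1 g38 probe `M38` (kernel-exact `rem3LJS`))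

Kernel facts + assembly; 0 sorry; standard axioms.  `--supports stmt-AtomisticToContinuum-27623`.
-/

namespace Summit.AtomisticToContinuum.Crystallization.Theorems.FrustratedLawDichotomyStrainedPatchHomEntryLeafHT

open Literature.Analysis.ValidatedNumerics.Numerics
open Summit.AtomisticToContinuum.Crystallization.Theorems.FrustratedLawDichotomyStrainedPatchHomCertTree (CertTree treeOK)
open Summit.AtomisticToContinuum.Crystallization.Theorems.FrustratedLawDichotomyStrainedPatchHomEntryTable (muRec)
open Summit.AtomisticToContinuum.Crystallization.Theorems.FrustratedLawDichotomyStrainedPatchHomEntryFitHcpCentred (entryLeafOKHQDCRS)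
open Summit.AtomisticToContinuum.Crystallization.Theorems.FrustratedLawDichotomyStrainedPatchHomSlopeLJ
open Summit.AtomisticToContinuum.Crystallization.Theorems.FrustratedLawDichotomyStrainedPatchHomSlopeLJAffine
open Summit.AtomisticToContinuum.Crystallization.Theorems.FrustratedLawDichotomyStrainedPatchHomSlopeLJAffine2Kit
open Summit.AtomisticToContinuum.Crystallization.Theorems.FrustratedLawDichotomyStrainedPatchHomSlopeLJAffine2KitS (rem3LJS)

set_option maxRecDepth 100000 in
set_option maxHeartbeats 4000000 in
/-- ★ KERNEL: `GnG72EV + far₁ + far₂ ≤ pG72EV.Gs`. -/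
theorem farG72EV : GnG72EV + htGsNA cG72E wG72E JG72E (htFar1U cG72E wG72E) + htGsNA cG72E wG72E JG72E (htFar2U cG72E wG72E) ≤ pG72EV.Gs := by
  decide +kernel

/-- ★★★ The sharp-remainder certificate side of the cell holds. [assembly] -/
theorem htCertSideA2QS_G72EV : htCertSideA2QS pG72EV QG72E GnG72EV JG72E cG72E wG72E = true :=
  htCertSideA2QS_of_parts restG72EV qG72E_0 qG72E_1 qG72E_2 linG72EV farG72EV

set_option maxRecDepth 100000 in
set_option maxHeartbeats 4000000 in
/-- ★ KERNEL: ONE inner hull leaf of the squared-test inner verdict close the confined box `htWr pG72EV`. -/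
theorem treeA2QS_G72EV : treeOK (hullInner (entryLeafOKHQDCRS muRec qX90c) JG72E cG72E) CertTree.leaf cG72E (htWr pG72EV cG72E wG72E) = true := by
  decide +kernel

/-- ★★★ **THE CELL CLOSES END TO END IN THE v3 CURRENCY.** [assembly] -/
theorem entryLeafOKHT4A2QSQDCRS_G72EV : entryLeafOKHT4A2QSQDCRS muRec qX90c pG72EV QG72E GnG72EV JG72E CertTree.leaf cG72E wG72E = true :=
  entryLeafOKHT4A2QSQDCRS_of_parts htCertSideA2QS_G72EV treeA2QS_G72EV

/-- ★ … hence the cell is a one-leaf ∃-tree of the production verdict v3 `entryLeafOKHT4A2QQDCRS3 muRec`. [formal bookkeeping] -/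
theorem okS3_G72E : ∃ t : CertTree ((Fin 3 × Fin 3) ⊕ Fin 3), treeOK (entryLeafOKHT4A2QQDCRS3 muRec) t cG72E wG72E = true :=
  exists_tree_HT4A2QQDCRS3_of_certS3 entryLeafOKHT4A2QSQDCRS_G72EV

end Summit.AtomisticToContinuum.Crystallization.Theorems.FrustratedLawDichotomyStrainedPatchHomEntryLeafHT
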